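import Summits.CriticalPhenomena.PercolationContinuityZ3.Theorems.PercNearOneGluingNoHeavyQuantAD3FourAtomDual
import Summits.CriticalPhenomena.PercolationContinuityZ3.Theorems.PercNearOneGluingNoHeavyQuantAD3TripleSplit
import HarnessLib

/-!
# QUANT lane R8, T-DEC, ROUTE 2: a four-atom law with a zero atom whose admissible set (on its mean polygon) is cut out
# by a LEVEL LINE is AD3⁺ — the geometric step (slide along the level line to two boundary laws on ≤ 3 atoms)

builds on p205010 (kernel theorem, internal audit signed; external expert review pending)

Support file (`--supports stmt-CriticalPhenomena-4575`), QUANT lane, seat prim-quant-arm-2 (gen 37), rung R8 of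
`run/shared/lean/prim/quant/LADDER.md`; third kernel piece of the proof of the Route-2 gate cell `LawDec.AD3GateTriple4`.
Memo `run/shared/lean/prim/quant/prim-quant-arm-2-g37/AD3-GATE4-G37.md` §0 (B).  Theorems only, standard axioms, no sorries.

THE GEOMETRY.  The mean-`T` laws on `{0, a, b, c}` form a polygon `P` (a quadrilateral or a triangle) whose vertices are the
mean-`T` PAIRS and whose edges are the mean-`T` laws on THREE of the atoms.  By `…QuantAD3FourAtomFlows`/`…Dual` the
admissible ones (gate DEC at every layer) are `P ∩ {θ·w_b + w_c ≥ const}` for one `θ` — so every law on the LEVEL LINE of an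
admissible `ν` inside `P` is admissible.  Sliding `ν` along that line (direction `d = (b − a − θ(c−a), cθ − b, a, −θa)`:
mass, mean and level preserved) in both directions until a mass vanishes writes `ν = t·ω₁ + (1−t)·ω₂` with `ω₁, ω₂`
admissible laws on ≤ 3 atoms; an admissible law on three atoms is AD3⁺ (typer g31's `ad3Decomp_of_admissibleTriple` for
positive masses; a pair is heavy, light-admissible, or a point); mixtures of AD3⁺ laws are AD3⁺ (`ad3Decomp_mixture`).

* `LawDec.exists_exhaust` — sliding a nonnegative vector along a direction with a negative entry until the first zero.
* `LawDec.ad3Decomp_of_admissiblePair`, `LawDec.ad3Decomp_of_admissibleLaw3` — admissible laws on ≤ 3 atoms are AD3⁺.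
* `LawDec.ad3Decomp_fourAtom_boundary` — a four-atom law with a vanishing mass, admissible, is AD3⁺.
* **`LawDec.ad3Decomp_fourAtom_of_levelLine`** — if every mean-`T` law on `{0,a,b,c}` on the level line `θ·v_b + v_c = θ·w_b + w_c`
  of `ν = (w₀, w_a, w_b, w_c)` has an admissible `q`-gate, then `ν` is AD3⁺ at `(y, q, T, M)`.
The regime bookkeeping (which `θ`, from `…Flows`/`…Dual`) and the cell `AD3GateTriple4` are assembled in `…QuantAD3FourAtomCell`.

[this work]; `ad3Decomp_of_admissibleTriple`: prim-quant-stmt g31; mixtures: prim-quant-stmt g31 (`ad3Decomp_mixture`) (this lane).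
The gluing rows served [cite: KozmaNitzan2024, Conjecture 3 (p. 15)]; product measure [cite: Grimmett1999, §1.3 p. 10].
-/

noncomputable section

namespace Summit.CriticalPhenomena.PercolationContinuityZ3.Theorems

namespace Quant

open Finset

/-- two-point law notation `TP[lo, hi, g, h] = g·[h = hi] + (1 − g)·[h = lo]` (as in the lane's other files). -/
local notation3 "TP[" lo ", " hi ", " g ", " h "]" =>
  (g : ℝ) * (if (h : ℕ) = (hi : ℕ) then (1 : ℝ) else 0) + (1 - (g : ℝ)) * (if (h : ℕ) = (lo : ℕ) then (1 : ℝ) else 0)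

/-- three-atom law notation `TR[s₁, s₂, s₃, p₁, p₂, p₃, h] = p₁·[h = s₁] + p₂·[h = s₂] + p₃·[h = s₃]`. -/
local notation3 "TR[" s₁ ", " s₂ ", " s₃ ", " p₁ ", " p₂ ", " p₃ ", " h "]" =>
  (p₁ : ℝ) * (if (h : ℕ) = (s₁ : ℕ) then (1 : ℝ) else 0) + (p₂ : ℝ) * (if (h : ℕ) = (s₂ : ℕ) then (1 : ℝ) else 0)
    + (p₃ : ℝ) * (if (h : ℕ) = (s₃ : ℕ) then (1 : ℝ) else 0)

/-- four-atom law notation `QD[a, b, c, Z, A, B, C, h] = Z·[h = 0] + A·[h = a] + B·[h = b] + C·[h = c]`. -/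
local notation3 "QD[" a ", " b ", " c ", " Z ", " A ", " B ", " C ", " h "]" =>
  (Z : ℝ) * (if (h : ℕ) = (0 : ℕ) then (1 : ℝ) else 0) + (A : ℝ) * (if (h : ℕ) = (a : ℕ) then (1 : ℝ) else 0)
    + (B : ℝ) * (if (h : ℕ) = (b : ℕ) then (1 : ℝ) else 0) + (C : ℝ) * (if (h : ℕ) = (c : ℕ) then (1 : ℝ) else 0)

namespace LawDec

/-! ### Sliding to the boundary -/

/-- **EXHAUSTION**: a vector `w ≥ 0` on a finite set, pushed along a direction `d` with a negative entry, first hits the boundary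
at `t = min_{d_k < 0} w_k/(−d_k) ≥ 0`: `w + t·d ≥ 0` with equality at some `k` with `d_k < 0`. [folklore] -/
theorem exists_exhaust {ι : Type*} (s : Finset ι) (w d : ι → ℝ) (hw : ∀ k ∈ s, 0 ≤ w k) (hneg : ∃ k ∈ s, d k < 0) :
    ∃ t : ℝ, 0 ≤ t ∧ (∀ k ∈ s, 0 ≤ w k + t * d k) ∧ ∃ k ∈ s, d k < 0 ∧ w k + t * d k = 0 := by
  classical
  set s' := s.filter (fun k => d k < 0) with hs'
  have hne : s'.Nonempty := by
    obtain ⟨k, hk, hdk⟩ := hneg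
    exact ⟨k, Finset.mem_filter.2 ⟨hk, hdk⟩⟩
  obtain ⟨k₀, hk₀, hmin⟩ := Finset.exists_min_image s' (fun k => w k / (-d k)) hne
  obtain ⟨hk₀s, hdk₀⟩ := Finset.mem_filter.1 hk₀
  have hd0 : 0 < -d k₀ := by linarith
  refine ⟨w k₀ / (-d k₀), div_nonneg (hw k₀ hk₀s) hd0.le, fun k hk => ?_, k₀, hk₀s, hdk₀, ?_⟩
  · by_cases hdk : d k < 0
    · have hle := hmin k (Finset.mem_filter.2 ⟨hk, hdk⟩)
      have hdk' : 0 < -d k := by linarith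
      rw [div_le_div_iff₀ hd0 hdk'] at hle
      -- `t·(−d k) ≤ w k`
      have : w k₀ / (-d k₀) * (-d k) ≤ w k := by
        rw [div_mul_eq_mul_div, div_le_iff₀ hd0]; linarith
      linarith
    · exact add_nonneg (hw k hk) (mul_nonneg (div_nonneg (hw k₀ hk₀s) hd0.le) (not_lt.1 hdk))
  · have hdne : d k₀ ≠ 0 := hdk₀.ne
    field_simp
    ring

/-! ### Admissible laws on at most three atoms are AD3⁺ -/

/-- **an admissible PAIR is AD3⁺**: `lo < hi ≤ M`, `γ ∈ [0,1]`, mean `T`, `0 < y ≤ q`, the `q`-gate DEC at every layer — a point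
mass (`γ ∈ {0,1}`), a heavy pair, or a light admissible pair. [this work] -/
theorem ad3Decomp_of_admissiblePair (y q T : ℝ) (M lo hi : ℕ) (γ : ℝ) (hyq : y ≤ q) (hlohi : lo < hi)
    (hhi : hi ≤ M) (hγ0 : 0 ≤ γ) (hγ1 : γ ≤ 1) (hT : (lo : ℝ) + ((hi : ℝ) - lo) * γ = T)
    (hD : ∀ j', j' < M → DECAt y j' M (gate (fun h => TP[lo, hi, γ, h]) q)) :
    AD3Decomp y q T M (fun h => TP[lo, hi, γ, h]) := by
  rcases hγ0.eq_or_lt with h0 | hpos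
  · -- `γ = 0`: the point mass at `lo = T`
    subst h0
    have e : (fun h : ℕ => TP[lo, hi, (0 : ℝ), h]) = fun h => if h = lo then (1 : ℝ) else 0 := by funext h; ring
    obtain rfl : T = (lo : ℝ) := by linarith
    rw [e]
    exact ad3Decomp_of_component (isAD3Component_point y q M lo (by omega) hyq)
  rcases hγ1.eq_or_lt with h1 | hlt
  · -- `γ = 1`: the point mass at `hi = T`
    subst h1
    have e : (fun h : ℕ => TP[lo, hi, (1 : ℝ), h]) = fun h => if h = hi then (1 : ℝ) else 0 := by funext h; ring
    obtain rfl : T = (hi : ℝ) := by linarith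
    rw [e]
    exact ad3Decomp_of_component (isAD3Component_point y q M hi hhi hyq)
  by_cases hheavy : y ≤ q * γ
  · exact ad3Decomp_of_component (Or.inl ⟨lo, hi, γ, hlohi.le, hhi, hγ0, hγ1, hheavy, hT, rfl⟩)
  · exact ad3Decomp_of_component (Or.inr (Or.inl ⟨lo, hi, γ, hlohi, hhi, hγ0, hγ1, lt_of_not_ge hheavy, hT, hD, rfl⟩))

/-- **an admissible law on THREE atoms is AD3⁺**: `s₁ < s₂ < s₃ ≤ M`, masses `pᵢ ≥ 0` summing to `1`, mean `T`, `0 < y ≤ q`, the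
`q`-gate DEC at every layer `j′ < M` — positive masses: typer g31's `ad3Decomp_of_admissibleTriple`; a vanishing mass: a pair. [this work] -/
theorem ad3Decomp_of_admissibleLaw3 (y q T : ℝ) (M s₁ s₂ s₃ : ℕ) (p₁ p₂ p₃ : ℝ) (hy0 : 0 < y) (hyq : y ≤ q)
    (h12 : s₁ < s₂) (h23 : s₂ < s₃) (h3 : s₃ ≤ M) (hp₁ : 0 ≤ p₁) (hp₂ : 0 ≤ p₂) (hp₃ : 0 ≤ p₃) (hp : p₁ + p₂ + p₃ = 1)
    (hT : p₁ * (s₁ : ℝ) + p₂ * (s₂ : ℝ) + p₃ * (s₃ : ℝ) = T)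
    (hD : ∀ j', j' < M → DECAt y j' M (gate (fun h => TR[s₁, s₂, s₃, p₁, p₂, p₃, h]) q)) :
    AD3Decomp y q T M (fun h => TR[s₁, s₂, s₃, p₁, p₂, p₃, h]) := by
  by_cases hz₁ : p₁ = 0
  · subst hz₁
    have hp₂' : p₂ = 1 - p₃ := by linarith
    have e : (fun h : ℕ => TR[s₁, s₂, s₃, (0 : ℝ), p₂, p₃, h]) = fun h => TP[s₂, s₃, p₃, h] := by
      funext h; rw [hp₂']; ring
    rw [e] at hD ⊢
    exact ad3Decomp_of_admissiblePair y q T M s₂ s₃ p₃ hyq h23 h3 hp₃ (by linarith)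
      (by rw [← hT, hp₂']; ring) hD
  by_cases hz₂ : p₂ = 0
  · subst hz₂
    have hp₁' : p₁ = 1 - p₃ := by linarith
    have e : (fun h : ℕ => TR[s₁, s₂, s₃, p₁, (0 : ℝ), p₃, h]) = fun h => TP[s₁, s₃, p₃, h] := by
      funext h; rw [hp₁']; ring
    rw [e] at hD ⊢
    exact ad3Decomp_of_admissiblePair y q T M s₁ s₃ p₃ hyq (h12.trans h23) h3 hp₃ (by linarith)
      (by rw [← hT, hp₁']; ring) hD
  by_cases hz₃ : p₃ = 0
  · subst hz₃
    have hp₁' : p₁ = 1 - p₂ := by linarith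
    have e : (fun h : ℕ => TR[s₁, s₂, s₃, p₁, p₂, (0 : ℝ), h]) = fun h => TP[s₁, s₂, p₂, h] := by
      funext h; rw [hp₁']; ring
    rw [e] at hD ⊢
    exact ad3Decomp_of_admissiblePair y q T M s₁ s₂ p₂ hyq h12 (by omega) hp₂ (by linarith)
      (by rw [← hT, hp₁']; ring) hD
  exact ad3Decomp_of_admissibleTriple y q T M s₁ s₂ s₃ p₁ p₂ p₃ hy0 hyq h12 h23 h3 (lt_of_le_of_ne hp₁ (Ne.symm hz₁))
    (lt_of_le_of_ne hp₂ (Ne.symm hz₂)) (lt_of_le_of_ne hp₃ (Ne.symm hz₃)) hp hT hD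

/-- **a four-atom law with a VANISHING mass whose `q`-gate is DEC at every layer is AD3⁺** (`0 < a < b < c ≤ M`, `0 < y ≤ q`):
it is a law on three of the atoms. [this work] -/
theorem ad3Decomp_fourAtom_boundary (y q T : ℝ) (M a b c : ℕ) (w₀ wa wb wc : ℝ) (ha : 0 < a) (hab : a < b) (hbc : b < c)
    (hcM : c ≤ M) (hy0 : 0 < y) (hyq : y ≤ q) (hw₀ : 0 ≤ w₀) (hwa : 0 ≤ wa) (hwb : 0 ≤ wb) (hwc : 0 ≤ wc)
    (hsum : w₀ + wa + wb + wc = 1) (hmean : (a : ℝ) * wa + (b : ℝ) * wb + (c : ℝ) * wc = T)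
    (hzero : w₀ = 0 ∨ wa = 0 ∨ wb = 0 ∨ wc = 0)
    (hD : ∀ j', j' < M → DECAt y j' M (gate (fun h => QD[a, b, c, w₀, wa, wb, wc, h]) q)) :
    AD3Decomp y q T M (fun h => QD[a, b, c, w₀, wa, wb, wc, h]) := by
  rcases hzero with hz | hz | hz | hz
  · subst hz
    have e : (fun h : ℕ => QD[a, b, c, (0 : ℝ), wa, wb, wc, h]) = fun h => TR[a, b, c, wa, wb, wc, h] := by
      funext h; ring
    rw [e] at hD ⊢
    exact ad3Decomp_of_admissibleLaw3 y q T M a b c wa wb wc hy0 hyq hab hbc hcM hwa hwb hwc (by linarith)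
      (by rw [← hmean]; ring) hD
  · subst hz
    have e : (fun h : ℕ => QD[a, b, c, w₀, (0 : ℝ), wb, wc, h]) = fun h => TR[0, b, c, w₀, wb, wc, h] := by
      funext h; ring
    rw [e] at hD ⊢
    exact ad3Decomp_of_admissibleLaw3 y q T M 0 b c w₀ wb wc hy0 hyq (by omega) hbc hcM hw₀ hwb hwc (by linarith)
      (by rw [← hmean]; push_cast; ring) hD
  · subst hz
    have e : (fun h : ℕ => QD[a, b, c, w₀, wa, (0 : ℝ), wc, h]) = fun h => TR[0, a, c, w₀, wa, wc, h] := by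
      funext h; ring
    rw [e] at hD ⊢
    exact ad3Decomp_of_admissibleLaw3 y q T M 0 a c w₀ wa wc hy0 hyq ha (hab.trans hbc) hcM hw₀ hwa hwc (by linarith)
      (by rw [← hmean]; push_cast; ring) hD
  · subst hz
    have e : (fun h : ℕ => QD[a, b, c, w₀, wa, wb, (0 : ℝ), h]) = fun h => TR[0, a, b, w₀, wa, wb, h] := by
      funext h; ring
    rw [e] at hD ⊢
    exact ad3Decomp_of_admissibleLaw3 y q T M 0 a b w₀ wa wb hy0 hyq ha hab (hbc.le.trans hcM) hw₀ hwa hwb (by linarith)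
      (by rw [← hmean]; push_cast; ring) hD

/-! ### The level-line theorem -/

/-- the four charged values of a four-atom law (`0 < a < b < c`). [folklore] -/
theorem QD_apply (a b c : ℕ) (Z A B C : ℝ) (ha : 0 < a) (hab : a < b) (hbc : b < c) :
    QD[a, b, c, Z, A, B, C, (0 : ℕ)] = Z ∧ QD[a, b, c, Z, A, B, C, a] = A ∧ QD[a, b, c, Z, A, B, C, b] = B ∧
      QD[a, b, c, Z, A, B, C, c] = C := by
  refine ⟨?_, ?_, ?_, ?_⟩
  · rw [if_pos rfl, if_neg (by omega), if_neg (by omega), if_neg (by omega)]; ring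
  · rw [if_neg (by omega), if_pos rfl, if_neg (by omega), if_neg (by omega)]; ring
  · rw [if_neg (by omega), if_neg (by omega), if_pos rfl, if_neg (by omega)]; ring
  · rw [if_neg (by omega), if_neg (by omega), if_neg (by omega), if_pos rfl]; ring

/-- **THE LEVEL-LINE THEOREM.**  `0 < a < b < c ≤ M`, `0 < y ≤ q`, `ν = (w₀, w_a, w_b, w_c) ≥ 0` a law on `{0,a,b,c}` of mean `T`,
and a slope `θ` such that EVERY mean-`T` law `(v₀, v_a, v_b, v_c) ≥ 0` on these atoms with `θ·v_b + v_c = θ·w_b + w_c` has its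
`q`-gate DEC at every layer `j′ < M`.  Then `ν` admits an AD3⁺ decomposition at `(y, q, T, M)`: if a mass of `ν` vanishes,
`ad3Decomp_fourAtom_boundary`; otherwise slide along `d = (b − a − θ(c − a), cθ − b, a, −θa)` (mass-, mean- and level-preserving)
to the two boundary laws `ω₁ = ν + t₁d`, `ω₂ = ν − t₂d` (`exists_exhaust`), both AD3⁺ by the boundary lemma, and
`ν = (t₂ω₁ + t₁ω₂)/(t₁ + t₂)` (`ad3Decomp_mixture`). [this work] -/
theorem ad3Decomp_fourAtom_of_levelLine (y q T θ : ℝ) (M a b c : ℕ) (w₀ wa wb wc : ℝ) (ha : 0 < a) (hab : a < b)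
    (hbc : b < c) (hcM : c ≤ M) (hy0 : 0 < y) (hyq : y ≤ q) (hw₀ : 0 ≤ w₀) (hwa : 0 ≤ wa) (hwb : 0 ≤ wb) (hwc : 0 ≤ wc)
    (hsum : w₀ + wa + wb + wc = 1) (hmean : (a : ℝ) * wa + (b : ℝ) * wb + (c : ℝ) * wc = T)
    (hline : ∀ v₀ va vb vc : ℝ, 0 ≤ v₀ → 0 ≤ va → 0 ≤ vb → 0 ≤ vc → v₀ + va + vb + vc = 1 →
      (a : ℝ) * va + (b : ℝ) * vb + (c : ℝ) * vc = T → θ * vb + vc = θ * wb + wc →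
      ∀ j', j' < M → DECAt y j' M (gate (fun h => QD[a, b, c, v₀, va, vb, vc, h]) q)) :
    AD3Decomp y q T M (fun h => QD[a, b, c, w₀, wa, wb, wc, h]) := by
  classical
  by_cases hbd : w₀ = 0 ∨ wa = 0 ∨ wb = 0 ∨ wc = 0
  · exact ad3Decomp_fourAtom_boundary y q T M a b c w₀ wa wb wc ha hab hbc hcM hy0 hyq hw₀ hwa hwb hwc hsum hmean hbd
      (hline w₀ wa wb wc hw₀ hwa hwb hwc hsum hmean rfl)
  push Not at hbd
  obtain ⟨hn₀, hna, hnb, hnc⟩ := hbd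
  have hp₀ : 0 < w₀ := lt_of_le_of_ne hw₀ (Ne.symm hn₀)
  have hpa : 0 < wa := lt_of_le_of_ne hwa (Ne.symm hna)
  have hpb : 0 < wb := lt_of_le_of_ne hwb (Ne.symm hnb)
  have hpc : 0 < wc := lt_of_le_of_ne hwc (Ne.symm hnc)
  -- the direction
  set d₀ : ℝ := (b : ℝ) - a - θ * ((c : ℝ) - a) with hd₀
  set da : ℝ := (c : ℝ) * θ - b with hda
  set dc : ℝ := -(θ * (a : ℝ)) with hdc
  have ha' : (0 : ℝ) < a := by exact_mod_cast ha
  have hdsum : d₀ + da + (a : ℝ) + dc = 0 := by simp only [hd₀, hda, hdc]; ring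
  have hdmean : (a : ℝ) * da + (b : ℝ) * (a : ℝ) + (c : ℝ) * dc = 0 := by simp only [hda, hdc]; ring
  have hdlevel : θ * (a : ℝ) + dc = 0 := by simp only [hdc]; ring
  obtain ⟨eZ, eA, eB, eC⟩ := QD_apply a b c w₀ wa wb wc ha hab hbc
  obtain ⟨dZ, dA, dB, dC⟩ := QD_apply a b c d₀ da (a : ℝ) dc ha hab hbc
  -- the atom set and the sign facts
  set s : Finset ℕ := {0, a, b, c} with hs
  have m0 : (0 : ℕ) ∈ s := by simp [hs]
  have ma : a ∈ s := by simp [hs]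
  have mb : b ∈ s := by simp [hs]
  have mc : c ∈ s := by simp [hs]
  have hmem : ∀ k ∈ s, k = 0 ∨ k = a ∨ k = b ∨ k = c := fun k hk => by simpa [hs] using hk
  have hws : ∀ k ∈ s, 0 ≤ QD[a, b, c, w₀, wa, wb, wc, k] := by
    intro k hk
    rcases hmem k hk with rfl | rfl | rfl | rfl
    · rw [eZ]; exact hw₀
    · rw [eA]; exact hwa
    · rw [eB]; exact hwb
    · rw [eC]; exact hwc
  have hneg₁ : ∃ k ∈ s, QD[a, b, c, d₀, da, (a : ℝ), dc, k] < 0 := by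
    by_contra hno
    push Not at hno
    have h1 := hno 0 m0; have h2 := hno a ma; have h3 := hno c mc
    rw [dZ] at h1; rw [dA] at h2; rw [dC] at h3
    have : d₀ + da + dc = -(a : ℝ) := by simp only [hd₀, hda, hdc]; ring
    linarith
  have hneg₂ : ∃ k ∈ s, -QD[a, b, c, d₀, da, (a : ℝ), dc, k] < 0 := ⟨b, mb, by rw [dB]; linarith⟩
  obtain ⟨t₁, ht₁, hpos₁, k₁, hk₁, hdk₁, hz₁⟩ :=
    exists_exhaust s (fun k => QD[a, b, c, w₀, wa, wb, wc, k]) (fun k => QD[a, b, c, d₀, da, (a : ℝ), dc, k]) hws hneg₁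
  obtain ⟨t₂, ht₂, hpos₂, k₂, hk₂, hdk₂, hz₂⟩ :=
    exists_exhaust s (fun k => QD[a, b, c, w₀, wa, wb, wc, k]) (fun k => -QD[a, b, c, d₀, da, (a : ℝ), dc, k]) hws hneg₂
  -- `t₁, t₂ > 0` since `ν` has no zero mass
  have hval : ∀ (t : ℝ) (k : ℕ), k ∈ s → QD[a, b, c, w₀, wa, wb, wc, k] + t * QD[a, b, c, d₀, da, (a : ℝ), dc, k] = 0 →
      t ≠ 0 := by
    intro t k hk hz ht
    subst ht
    rw [zero_mul, add_zero] at hz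
    rcases hmem k hk with rfl | rfl | rfl | rfl
    · rw [eZ] at hz; exact hn₀ hz
    · rw [eA] at hz; exact hna hz
    · rw [eB] at hz; exact hnb hz
    · rw [eC] at hz; exact hnc hz
  have ht₁0 : 0 < t₁ := lt_of_le_of_ne ht₁ (Ne.symm (hval t₁ k₁ hk₁ hz₁))
  have hz₂' : QD[a, b, c, w₀, wa, wb, wc, k₂] + (-t₂) * QD[a, b, c, d₀, da, (a : ℝ), dc, k₂] = 0 := by
    linarith [hz₂]
  have ht₂0 : 0 < t₂ := by
    have := hval (-t₂) k₂ hk₂ hz₂'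
    rcases ht₂.eq_or_lt with h | h
    · exact absurd (by rw [← h, neg_zero]) this
    · exact h
  -- the two boundary laws
  have hω : ∀ t : ℝ, (∀ k ∈ s, 0 ≤ QD[a, b, c, w₀, wa, wb, wc, k] + t * QD[a, b, c, d₀, da, (a : ℝ), dc, k]) →
      (∃ k ∈ s, QD[a, b, c, w₀, wa, wb, wc, k] + t * QD[a, b, c, d₀, da, (a : ℝ), dc, k] = 0) →
      AD3Decomp y q T M (fun h => QD[a, b, c, w₀ + t * d₀, wa + t * da, wb + t * (a : ℝ), wc + t * dc, h]) := by
    intro t hpos hzero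
    have g0 := hpos 0 m0; have ga := hpos a ma; have gb := hpos b mb; have gc := hpos c mc
    rw [eZ, dZ] at g0; rw [eA, dA] at ga; rw [eB, dB] at gb; rw [eC, dC] at gc
    refine ad3Decomp_fourAtom_boundary y q T M a b c _ _ _ _ ha hab hbc hcM hy0 hyq g0 ga gb gc
      (by linear_combination hsum + t * hdsum) (by linear_combination hmean + t * hdmean) ?_
      (hline _ _ _ _ g0 ga gb gc (by linear_combination hsum + t * hdsum) (by linear_combination hmean + t * hdmean)
        (by linear_combination t * hdlevel))
    obtain ⟨k, hk, hk0⟩ := hzero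
    rcases hmem k hk with rfl | rfl | rfl | rfl
    · rw [eZ, dZ] at hk0; exact Or.inl hk0
    · rw [eA, dA] at hk0; exact Or.inr (Or.inl hk0)
    · rw [eB, dB] at hk0; exact Or.inr (Or.inr (Or.inl hk0))
    · rw [eC, dC] at hk0; exact Or.inr (Or.inr (Or.inr hk0))
  have hω₁ := hω t₁ hpos₁ ⟨k₁, hk₁, hz₁⟩
  have hω₂ := hω (-t₂) (fun k hk => by linarith [hpos₂ k hk]) ⟨k₂, hk₂, hz₂'⟩
  -- the mixture
  have hS : 0 < t₁ + t₂ := by linarith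
  have hSne : t₁ + t₂ ≠ 0 := hS.ne'
  refine ad3Decomp_mixture (ι := Bool) y q T M _ (fun i => cond i (t₂ / (t₁ + t₂)) (t₁ / (t₁ + t₂)))
    (fun i => cond i (fun h => QD[a, b, c, w₀ + t₁ * d₀, wa + t₁ * da, wb + t₁ * (a : ℝ), wc + t₁ * dc, h])
      (fun h => QD[a, b, c, w₀ + -t₂ * d₀, wa + -t₂ * da, wb + -t₂ * (a : ℝ), wc + -t₂ * dc, h]))
    (fun i => by cases i <;> simp only [cond_true, cond_false] <;> positivity) ?_ (fun h => ?_) ?_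
  · simp only [Fintype.sum_bool, cond_true, cond_false]
    rw [← add_div, div_eq_one_iff_eq hSne, add_comm]
  · simp only [Fintype.sum_bool, cond_true, cond_false]
    rw [div_mul_eq_mul_div, div_mul_eq_mul_div, ← add_div, eq_div_iff hSne]
    ring
  · intro i _
    cases i
    · simpa only [cond_false] using hω₂
    · simpa only [cond_true] using hω₁

end LawDec

end Quant

end Summit.CriticalPhenomena.PercolationContinuityZ3.Theorems
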